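import Mathlib.Topology.Algebra.OpenSubgroup
import Mathlib.Topology.Algebra.Group.ClosedSubgroup
import Mathlib.Topology.Separation.Profinite
import Mathlib.GroupTheory.Index
import Mathlib.NumberTheory.Padics.RingHoms
import Mathlib.Data.Nat.ChineseRemainder
import Mathlib.Data.Nat.Factorization.Induction
import Literature.AnabelianGeometry.AbsoluteAnabelian.FundamentalExtension
import Literature.AnabelianGeometry.AbsoluteAnabelian.AbsTopII.InertiaGroups
import HarnessLib

/-!
# The structure theorem behind the interface predicates for "`≅ Ẑ`": a free procyclic profinite
# group is `∏_p ℤ_p`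

[AbsTopI] §0 p. 7 ("The profinite completion of the group `ℤ` will be denoted `Ẑ`"), [AbsTopIII]
Prop. 1.4 (i) p. 31 (the inertia group `I_x` of a cusp "is naturally isomorphic to `Ẑ(1)`") and
[AbsTopII] Prop. 1.3 (i) p. 11 ("as abstract profinite groups, `≅ Ẑ^Σ`") are typed in the cell by
INTRINSIC predicates on a topological group: abc-iut-L4-t1's `FundamentalExtension.IsFreeProcyclic`
(a dense cyclic subgroup; an open subgroup of every positive index) and abc-iut-L4-t6's
`AbsTopII.IsFreeProSigmaCyclic Σ` (a dense cyclic subgroup; the indices of open subgroups are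
exactly the `Σ`-integers). This proof-only file (no definitions) VALIDATES these typings for
profinite groups: a compact Hausdorff totally disconnected group satisfying `IsFreeProcyclic`
(equivalently, `IsFreeProSigmaCyclic Set.univ`) is isomorphic as a topological group to `Ẑ` realised
as `∏_p ℤ_p` (Mathlib's `PadicInt`, indexed by `Nat.Primes` — the coefficient ring `ZHatCoeff` of
the cell's cyclotomes up to `ULift`), by an isomorphism sending the topological generator to `1`
(`FundamentalExtension.IsFreeProcyclic.exists_continuousMulEquiv_padicProd`, additive form
`exists_continuousAddEquiv_padicProd`, closed-subgroup form `…_of_isClosed`).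

Route (elementary; every step PROVED here): a Hausdorff group with dense `⟨g⟩` is commutative; its
open subgroup of index `n` is UNIQUE and equals `closure ⟨gⁿ⟩`
(`eq_closureZpowersPow_of_isOpen_of_index`); `gᵏ ∈ closure ⟨gⁿ⟩ ↔ n ∣ k`; the residues mod `p^k` of
an element form a `p`-adically Cauchy sequence, giving a continuous `p`-adic coordinate `G → ℤ_p`
(`exists_padicCoordinate`, Mathlib's `PadicInt.ofIntSeq`); coprime indices intersect
(`closureZpowersPow_inf_of_coprime`), so the product map is injective (open subgroups separate
points in a profinite group); `ℕ` is dense in `∏_p ℤ_p` (Chinese remainder theorem,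
`dense_range_natCast_padicProd`), so the compact image is everything; a continuous bijection from a
compact space to a Hausdorff space is a homeomorphism.

Consumers: the bijectivity of the synchronization `I_x → M_X` of [AbsTopIII] Thm 1.9 (b) / Prop 1.4
(ii) (abc-iut-L4-t1 `CurveModel.Thm_1_9_b_natural`, with `I_x` free procyclic), together with
abc-iut-L4-t1's `End_ℤ(Ẑ) = Ẑ` (`PadicProductEndomorphisms`). HONEST FRAMING: classical profinite
group theory; nothing here bears on [IUTchIII] Cor 3.12.
-/

noncomputable section

open Topology

namespace Literature.AnabelianGeometry.AbsoluteAnabelian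

open Literature.AnabelianGeometry.Anabelioids (IsSigmaInteger)

universe u

variable {G : Type u} [Group G] [TopologicalSpace G] [IsTopologicalGroup G]

/-- A Hausdorff topological group with a dense cyclic subgroup is commutative. [cite:
MochizukiAbsTopI2012, §0 p.7] -/
theorem mul_comm_of_dense_zpowers [T2Space G] {g : G} (hg : Dense (Subgroup.zpowers g : Set G))
    (x y : G) : x * y = y * x := by
  have hclosed : IsClosed {q : G × G | q.1 * q.2 = q.2 * q.1} :=
    isClosed_eq (continuous_fst.mul continuous_snd) (continuous_snd.mul continuous_fst)
  have hdense : Dense ((Subgroup.zpowers g : Set G) ×ˢ (Subgroup.zpowers g : Set G)) :=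
    hg.prod hg
  have hsub : ((Subgroup.zpowers g : Set G) ×ˢ (Subgroup.zpowers g : Set G)) ⊆
      {q : G × G | q.1 * q.2 = q.2 * q.1} := by
    rintro ⟨a, b⟩ ⟨ha, hb⟩
    obtain ⟨i, rfl⟩ := Subgroup.mem_zpowers_iff.mp ha
    obtain ⟨j, rfl⟩ := Subgroup.mem_zpowers_iff.mp hb
    exact zpow_mul_comm g i j
  have huniv : {q : G × G | q.1 * q.2 = q.2 * q.1} = Set.univ := by
    apply Set.eq_univ_of_univ_subset
    rw [← hdense.closure_eq]
    exact closure_minimal hsub hclosed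
  have : (x, y) ∈ {q : G × G | q.1 * q.2 = q.2 * q.1} := by rw [huniv]; trivial
  exact this

/-- In a Hausdorff group with a dense cyclic subgroup every subgroup is normal. [folklore] -/
private theorem normal_of_dense_zpowers [T2Space G] {g : G}
    (hg : Dense (Subgroup.zpowers g : Set G))
    (H : Subgroup G) : H.Normal :=
  ⟨fun x hx y => by rwa [mul_comm_of_dense_zpowers hg y x, mul_inv_cancel_right]⟩

/-- The closed subgroup `K_n := closure ⟨gⁿ⟩`. [folklore] -/
private theorem mem_closureZpowersPow_of_mem_zpowers_pow {g : G} {n : ℕ} {x : G}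
    (hx : x ∈ Subgroup.zpowers (g ^ n)) : x ∈ (Subgroup.zpowers (g ^ n)).topologicalClosure :=
  Subgroup.le_topologicalClosure _ hx

/-- The cosets `gⁱ · closure ⟨gⁿ⟩`, `i < n`, cover a group with dense `⟨g⟩` (`n ≥ 1`). [folklore] -/
private theorem exists_lt_mem_coset_closureZpowersPow {g : G}
    (hg : Dense (Subgroup.zpowers g : Set G))
    {n : ℕ} (hn : 0 < n) (x : G) :
    ∃ i : ℕ, i < n ∧ (g ^ i)⁻¹ * x ∈ (Subgroup.zpowers (g ^ n)).topologicalClosure := by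
  set K := (Subgroup.zpowers (g ^ n)).topologicalClosure with hK
  -- the finite union of the closed cosets `gⁱ K`, `i < n`
  let S : Set G := ⋃ i ∈ Finset.range n, (fun k => g ^ i * k) '' (K : Set G)
  have hSclosed : IsClosed S := by
    refine Set.Finite.isClosed_biUnion (Finset.range n).finite_toSet fun i _ => ?_
    have : (fun k => g ^ i * k) '' (K : Set G) =
        (Homeomorph.mulLeft (g ^ i) : G ≃ₜ G) '' (K : Set G) := rfl
    rw [this]
    exact (Homeomorph.mulLeft (g ^ i)).isClosed_image.mpr
      (Subgroup.isClosed_topologicalClosure _)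
  have hsub : (Subgroup.zpowers g : Set G) ⊆ S := by
    intro y hy
    obtain ⟨m, rfl⟩ := Subgroup.mem_zpowers_iff.mp hy
    -- `g^m = g^(m mod n) * (g^n)^(m div n)`
    have hn' : (n : ℤ) ≠ 0 := by exact_mod_cast hn.ne'
    refine Set.mem_iUnion₂.mpr ⟨(m % n).toNat, ?_, ⟨(g ^ n) ^ (m / n), ?_, ?_⟩⟩
    · rw [Finset.mem_range]
      have h0 : 0 ≤ m % n := Int.emod_nonneg _ hn'
      have h1 : m % n < n := Int.emod_lt_of_pos _ (by exact_mod_cast hn)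
      omega
    · exact Subgroup.le_topologicalClosure _ (Subgroup.zpow_mem_zpowers _ _)
    · have h0 : 0 ≤ m % n := Int.emod_nonneg _ hn'
      change g ^ (m % ↑n).toNat * (g ^ n) ^ (m / ↑n) = g ^ m
      rw [← zpow_natCast g n, ← zpow_mul, ← zpow_natCast, Int.toNat_of_nonneg h0, ← zpow_add,
        Int.emod_add_mul_ediv]
  have huniv : S = Set.univ := by
    apply Set.eq_univ_of_univ_subset
    rw [← hg.closure_eq]
    exact closure_minimal hsub hSclosed
  have hx : x ∈ S := by rw [huniv]; trivial
  obtain ⟨i, hi, k, hk, hkx⟩ := Set.mem_iUnion₂.mp hx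
  refine ⟨i, by simpa using hi, ?_⟩
  rw [← hkx, ← mul_assoc, inv_mul_cancel, one_mul]
  exact hk

/-- `closure ⟨gⁿ⟩` has index at most `n` (its cosets are among `gⁱ K`, `i < n`). [folklore] -/
private theorem index_closureZpowersPow_le {g : G} (hg : Dense (Subgroup.zpowers g : Set G)) {n : ℕ}
    (hn : 0 < n) : ((Subgroup.zpowers (g ^ n)).topologicalClosure).index ≤ n ∧
      ((Subgroup.zpowers (g ^ n)).topologicalClosure).FiniteIndex := by
  set K := (Subgroup.zpowers (g ^ n)).topologicalClosure with hK
  -- the map `Fin n → G ⧸ K`, `i ↦ gⁱ K`, is surjective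
  have hsurj : Function.Surjective (fun i : Fin n => (QuotientGroup.mk (g ^ (i : ℕ)) : G ⧸ K)) := by
    intro q
    induction q using QuotientGroup.induction_on with
    | H x =>
      obtain ⟨i, hi, hix⟩ := exists_lt_mem_coset_closureZpowersPow hg hn x
      refine ⟨⟨i, hi⟩, ?_⟩
      rw [QuotientGroup.eq]
      exact hix
  haveI : Finite (G ⧸ K) := Finite.of_surjective _ hsurj
  refine ⟨?_, Subgroup.finiteIndex_of_finite_quotient⟩
  rw [Subgroup.index]
  calc Nat.card (G ⧸ K) ≤ Nat.card (Fin n) := Nat.card_le_card_of_surjective _ hsurj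
    _ = n := by simp

/-- **Uniqueness of the open subgroup of index `n`**: in a Hausdorff topological group with a dense
cyclic subgroup `⟨g⟩`, every open subgroup of finite index `n ≥ 1` equals `closure ⟨gⁿ⟩`. [cite:
MochizukiAbsTopI2012, §0 p.7] -/
theorem eq_closureZpowersPow_of_isOpen_of_index [T2Space G] {g : G}
    (hg : Dense (Subgroup.zpowers g : Set G)) {H : Subgroup G} (hH : IsOpen (H : Set G)) {n : ℕ}
    (hn : 0 < n) (hidx : H.index = n) : H = (Subgroup.zpowers (g ^ n)).topologicalClosure := by
  set K := (Subgroup.zpowers (g ^ n)).topologicalClosure with hK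
  haveI : H.Normal := normal_of_dense_zpowers hg H
  -- `gⁿ ∈ H` since `G ⧸ H` has order `n`
  have hgn : g ^ n ∈ H := by
    rw [← QuotientGroup.eq_one_iff, QuotientGroup.mk_pow, ← hidx, Subgroup.index]
    exact pow_card_eq_one'
  -- hence `K ≤ H` (`H` is closed)
  have hKH : K ≤ H := by
    rw [hK]
    refine (Subgroup.topologicalClosure_minimal _ ?_ (OpenSubgroup.isClosed ⟨H, hH⟩))
    exact (Subgroup.zpowers_le).mpr hgn
  -- compare indices
  obtain ⟨hKle, hKfin⟩ := index_closureZpowersPow_le hg hn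
  haveI := hKfin
  have hmul : K.index = H.index * K.relIndex H := by
    rw [mul_comm]; exact (Subgroup.relIndex_mul_index hKH).symm
  have hKne : K.index ≠ 0 := Subgroup.FiniteIndex.index_ne_zero
  have hrel : K.relIndex H = 1 := by
    have h2 : 0 < H.index := by rw [hidx]; exact hn
    have hle : H.index * K.relIndex H ≤ H.index * 1 := by rw [mul_one, ← hmul, hidx]; exact hKle
    have h3 : K.relIndex H ≤ 1 := Nat.le_of_mul_le_mul_left hle h2
    have h4 : K.relIndex H ≠ 0 := fun h0 => hKne (by rw [hmul, h0, mul_zero])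
    omega
  have hHK : H ≤ K := Subgroup.relIndex_eq_one.mp hrel
  exact le_antisymm hHK hKH

/-! ### Residues modulo `closure ⟨gⁿ⟩` and `gᵏ ∈ closure ⟨gⁿ⟩ ↔ n ∣ k` -/

section Residues

variable [T2Space G] {g : G}

omit [T2Space G] in
/-- If `closure ⟨gⁿ⟩` has index exactly `n ≥ 1`, then `gᵏ ∈ closure ⟨gⁿ⟩ ↔ n ∣ k`. [cite:
MochizukiAbsTopI2012, §0 p.7] -/
theorem zpow_mem_closureZpowersPow_iff (hg : Dense (Subgroup.zpowers g : Set G)) {n : ℕ}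
    (hn : 0 < n)
    (hidx : ((Subgroup.zpowers (g ^ n)).topologicalClosure).index = n) (k : ℤ) :
    g ^ k ∈ (Subgroup.zpowers (g ^ n)).topologicalClosure ↔ (n : ℤ) ∣ k := by
  set K := (Subgroup.zpowers (g ^ n)).topologicalClosure with hK
  constructor
  · intro hk
    -- write `k = (k % n) + n * (k / n)`; the residue `r` satisfies `g ^ r ∈ K`
    have hn' : (n : ℤ) ≠ 0 := by exact_mod_cast hn.ne'
    set r := k % n with hr
    have h0 : 0 ≤ r := Int.emod_nonneg _ hn'
    have h1 : r < n := Int.emod_lt_of_pos _ (by exact_mod_cast hn)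
    have hgr : g ^ r ∈ K := by
      have heq : g ^ k = g ^ r * (g ^ n) ^ (k / n) := by
        rw [← zpow_natCast g n, ← zpow_mul, ← zpow_add, hr, Int.emod_add_mul_ediv]
      have hmem : (g ^ n) ^ (k / n) ∈ K :=
        Subgroup.le_topologicalClosure _ (Subgroup.zpow_mem_zpowers _ _)
      have h2 := K.mul_mem hk (K.inv_mem hmem)
      rwa [heq, mul_inv_cancel_right] at h2
    -- if `r ≠ 0` then `K ⊇ closure ⟨g^r⟩`, whose index is `≤ r < n`: contradiction
    by_contra hndvd
    have hr0 : r ≠ 0 := fun h => hndvd (Int.dvd_of_emod_eq_zero (hr ▸ h))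
    have hrpos : 0 < r.toNat := by omega
    have hgr' : g ^ r.toNat ∈ K := by
      rw [← zpow_natCast, Int.toNat_of_nonneg h0]; exact hgr
    have hle : (Subgroup.zpowers (g ^ r.toNat)).topologicalClosure ≤ K :=
      Subgroup.topologicalClosure_minimal _ ((Subgroup.zpowers_le).mpr hgr')
        (Subgroup.isClosed_topologicalClosure _)
    obtain ⟨hidx', hfin'⟩ := index_closureZpowersPow_le hg hrpos
    haveI := hfin'
    have hdvd : K.index ∣ ((Subgroup.zpowers (g ^ r.toNat)).topologicalClosure).index :=
      Subgroup.index_dvd_of_le hle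
    have hle' : n ≤ r.toNat := by
      rw [hidx] at hdvd
      exact (Nat.le_of_dvd (Nat.pos_of_ne_zero Subgroup.FiniteIndex.index_ne_zero) hdvd).trans hidx'
    omega
  · rintro ⟨q, rfl⟩
    rw [zpow_mul, zpow_natCast]
    exact Subgroup.le_topologicalClosure _ (Subgroup.zpow_mem_zpowers _ _)

omit [T2Space G] in
/-- Two integer "residues" of the same element differ by a multiple of `n`. [folklore] -/
private theorem residue_congr (hg : Dense (Subgroup.zpowers g : Set G)) {n : ℕ} (hn : 0 < n)
    (hidx : ((Subgroup.zpowers (g ^ n)).topologicalClosure).index = n) {x : G} {i j : ℤ}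
    (hi : (g ^ i)⁻¹ * x ∈ (Subgroup.zpowers (g ^ n)).topologicalClosure)
    (hj : (g ^ j)⁻¹ * x ∈ (Subgroup.zpowers (g ^ n)).topologicalClosure) :
    (n : ℤ) ∣ i - j := by
  set K := (Subgroup.zpowers (g ^ n)).topologicalClosure
  have h : (g ^ j)⁻¹ * x * ((g ^ i)⁻¹ * x)⁻¹ ∈ K := K.mul_mem hj (K.inv_mem hi)
  have h' : (g ^ j)⁻¹ * x * ((g ^ i)⁻¹ * x)⁻¹ = g ^ (i - j) := by
    rw [mul_inv_rev, inv_inv, mul_assoc, mul_inv_cancel_left, ← zpow_neg, ← zpow_add]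
    ring_nf
  rw [h'] at h
  exact (zpow_mem_closureZpowersPow_iff hg hn hidx _).mp h

/-- Residues are multiplicative: residues of `x`, `y` add up to a residue of `x * y`. [folklore] -/
private theorem residue_mul (hg : Dense (Subgroup.zpowers g : Set G)) {n : ℕ} {x y : G} {i j : ℤ}
    (hi : (g ^ i)⁻¹ * x ∈ (Subgroup.zpowers (g ^ n)).topologicalClosure)
    (hj : (g ^ j)⁻¹ * y ∈ (Subgroup.zpowers (g ^ n)).topologicalClosure) :
    (g ^ (i + j))⁻¹ * (x * y) ∈ (Subgroup.zpowers (g ^ n)).topologicalClosure := by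
  set K := (Subgroup.zpowers (g ^ n)).topologicalClosure
  have h := K.mul_mem hi hj
  have hcomm : ∀ a b : G, a * b = b * a := mul_comm_of_dense_zpowers hg
  have h' : (g ^ i)⁻¹ * x * ((g ^ j)⁻¹ * y) = (g ^ (i + j))⁻¹ * (x * y) := by
    rw [zpow_add, mul_inv_rev, hcomm ((g ^ j)⁻¹) ((g ^ i)⁻¹)]
    rw [mul_assoc, mul_assoc, ← mul_assoc x, hcomm x ((g ^ j)⁻¹), mul_assoc]
  rw [h'] at h
  exact h

omit [T2Space G] in
/-- Residues along a divisor: a residue mod `n` is a residue mod `m` for `m ∣ n`. [folklore] -/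
private theorem residue_of_dvd {m n : ℕ} (hmn : m ∣ n) {x : G} {i : ℤ}
    (hi : (g ^ i)⁻¹ * x ∈ (Subgroup.zpowers (g ^ n)).topologicalClosure) :
    (g ^ i)⁻¹ * x ∈ (Subgroup.zpowers (g ^ m)).topologicalClosure := by
  refine Subgroup.topologicalClosure_mono ?_ hi
  obtain ⟨q, rfl⟩ := hmn
  rw [Subgroup.zpowers_le, pow_mul]
  exact Subgroup.pow_mem _ (Subgroup.mem_zpowers _) _

end Residues


/-! ### Profinite groups: open subgroups separate points -/

section Separation

omit [IsTopologicalGroup G] in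
/-- In a compact Hausdorff totally disconnected topological group, an element lying in every open
subgroup is trivial. [cite: MochizukiAbsTopI2012, §0 p.7] -/
theorem eq_one_of_forall_isOpen_mem [IsTopologicalGroup G] [CompactSpace G] [T2Space G]
    [TotallyDisconnectedSpace G] {x : G}
    (hx : ∀ H : Subgroup G, IsOpen (H : Set G) → x ∈ H) : x = 1 := by
  by_contra hne
  -- a clopen set containing `1` but not `x`
  obtain ⟨W, hW, h1W, hxW⟩ :=
    exists_isClopen_of_totally_separated (α := G) (Ne.symm hne)
  obtain ⟨H, hH⟩ := IsTopologicalGroup.exist_openSubgroup_sub_clopen_nhds_of_one hW h1W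
  exact hxW (hH (hx H H.isOpen))

end Separation

/-! ### The `p`-adic coordinate -/

section Coordinate

variable [T2Space G] {g : G}

/-- With open subgroups of every positive index available, `closure ⟨gⁿ⟩` IS the open subgroup of
index `n`. [cite: MochizukiAbsTopI2012, §0 p.7] -/
theorem isOpen_closureZpowersPow (hg : Dense (Subgroup.zpowers g : Set G)) {n : ℕ}
    (hn : 0 < n) (hex : ∃ H : Subgroup G, IsOpen (H : Set G) ∧ H.index = n) :
    IsOpen ((Subgroup.zpowers (g ^ n)).topologicalClosure : Set G) ∧
      ((Subgroup.zpowers (g ^ n)).topologicalClosure).index = n := by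
  obtain ⟨H, hH, hidx⟩ := hex
  have := eq_closureZpowersPow_of_isOpen_of_index hg hH hn hidx
  subst this
  exact ⟨hH, hidx⟩

omit [T2Space G] in
/-- Every element has a natural-number residue `i < n` modulo `closure ⟨gⁿ⟩` (as an integer power).
[folklore] -/
private theorem exists_residue (hg : Dense (Subgroup.zpowers g : Set G)) {n : ℕ} (hn : 0 < n)
    (x : G) :
    ∃ i : ℕ, i < n ∧ (g ^ (i : ℤ))⁻¹ * x ∈ (Subgroup.zpowers (g ^ n)).topologicalClosure := by
  obtain ⟨i, hi, hix⟩ := exists_lt_mem_coset_closureZpowersPow hg hn x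
  exact ⟨i, hi, by rwa [zpow_natCast]⟩

/-- **The `p`-adic coordinate.**  For a Hausdorff topological group with dense `⟨g⟩` and an open
subgroup of every positive index, and a prime `p`, there is a continuous homomorphism
`Φ : G → ℤ_p` (written `G →* Multiplicative ℤ_p`) whose reduction mod `p^k` reads off the residue of
an element modulo `closure ⟨g^{p^k}⟩`. [cite: MochizukiAbsTopI2012, §0 p.7] -/
theorem exists_padicCoordinate (hg : Dense (Subgroup.zpowers g : Set G))
    (p : ℕ) [hp : Fact p.Prime]
    (hallp : ∀ k : ℕ, ∃ H : Subgroup G, IsOpen (H : Set G) ∧ H.index = p ^ k) :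
    ∃ Φ : G →* Multiplicative ℤ_[p], Continuous Φ ∧
      ∀ (x : G) (k : ℕ) (i : ℤ),
        (g ^ i)⁻¹ * x ∈ (Subgroup.zpowers (g ^ (p ^ k))).topologicalClosure →
          PadicInt.toZModPow k (Multiplicative.toAdd (Φ x)) = (i : ZMod (p ^ k)) := by
  classical
  have hpk : ∀ k : ℕ, 0 < p ^ k := fun k => pow_pos hp.out.pos k
  have hidx : ∀ k : ℕ, ((Subgroup.zpowers (g ^ (p ^ k))).topologicalClosure).index = p ^ k :=
    fun k => (isOpen_closureZpowersPow hg (hpk k) (hallp k)).2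
  -- choose natural-number residues
  choose res hres_lt hres using fun (k : ℕ) (x : G) => exists_residue hg (hpk k) x
  -- the integer sequence of residues of `x` is `p`-adically Cauchy
  have hdiv : ∀ (x : G) (k : ℕ), (p : ℤ) ^ k ∣ (res (k + 1) x : ℤ) - (res k x : ℤ) := by
    intro x k
    have h1 : (g ^ ((res (k + 1) x : ℕ) : ℤ))⁻¹ * x ∈
        (Subgroup.zpowers (g ^ (p ^ k))).topologicalClosure :=
      residue_of_dvd (pow_dvd_pow p (Nat.le_succ k)) (hres (k + 1) x)
    have := residue_congr hg (hpk k) (hidx k) h1 (hres k x)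
    exact_mod_cast this
  -- the coordinate as a function
  let Φ₀ : G → ℤ_[p] := fun x =>
    PadicInt.ofIntSeq _
      (PadicInt.isCauSeq_padicNorm_of_pow_dvd_sub (fun k => (res k x : ℤ)) p (hdiv x))
  have hΦ₀ : ∀ (x : G) (k : ℕ), PadicInt.toZModPow k (Φ₀ x) = ((res k x : ℤ) : ZMod (p ^ k)) :=
    fun x k => PadicInt.toZModPow_ofIntSeq_of_pow_dvd_sub (fun k => (res k x : ℤ)) p (hdiv x) k
  -- any residue computes the reduction
  have hchar : ∀ (x : G) (k : ℕ) (i : ℤ),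
      (g ^ i)⁻¹ * x ∈ (Subgroup.zpowers (g ^ (p ^ k))).topologicalClosure →
        PadicInt.toZModPow k (Φ₀ x) = (i : ZMod (p ^ k)) := by
    intro x k i hi
    rw [hΦ₀]
    have hd := residue_congr hg (hpk k) (hidx k) hi (hres k x)
    rw [ZMod.intCast_eq_intCast_iff_dvd_sub]
    push_cast
    exact hd
  -- multiplicativity
  have hmul : ∀ x y : G, Φ₀ (x * y) = Φ₀ x + Φ₀ y := by
    intro x y
    apply PadicInt.ext_of_toZModPow.mp
    intro k
    have h := residue_mul hg (hres k x) (hres k y)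
    rw [hchar (x * y) k _ h, map_add, hΦ₀, hΦ₀]
    push_cast
    ring
  have hone : Φ₀ 1 = 0 := by
    have h := hmul 1 1
    rw [mul_one] at h
    -- `a = a + a` ⇒ `a = 0`
    have := congrArg (fun z => z - Φ₀ 1) h
    simpa using this.symm
  let Φ : G →* Multiplicative ℤ_[p] :=
    { toFun := fun x => Multiplicative.ofAdd (Φ₀ x)
      map_one' := by rw [hone]; rfl
      map_mul' := fun x y => by rw [hmul]; rfl }
  -- continuity
  have hinv : ∀ x y : G, Φ₀ (x⁻¹ * y) = Φ₀ y - Φ₀ x := by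
    intro x y
    have h := hmul x (x⁻¹ * y)
    rw [mul_inv_cancel_left] at h
    rw [h]; ring
  have hcont₀ : Continuous Φ₀ := by
    rw [continuous_iff_continuousAt]
    intro x
    rw [ContinuousAt, Metric.tendsto_nhds]
    intro ε hε
    obtain ⟨k, hk⟩ := PadicInt.exists_pow_neg_lt p hε
    have hopen : IsOpen ((fun y => x⁻¹ * y) ⁻¹'
        ((Subgroup.zpowers (g ^ (p ^ k))).topologicalClosure : Set G)) :=
      (isOpen_closureZpowersPow hg (hpk k) (hallp k)).1.preimage (continuous_const_mul x⁻¹)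
    have hxmem : x ∈ (fun y => x⁻¹ * y) ⁻¹'
        ((Subgroup.zpowers (g ^ (p ^ k))).topologicalClosure : Set G) := by
      change x⁻¹ * x ∈ (Subgroup.zpowers (g ^ (p ^ k))).topologicalClosure
      rw [inv_mul_cancel]; exact Subgroup.one_mem _
    filter_upwards [hopen.mem_nhds hxmem] with y hy
    change x⁻¹ * y ∈ (Subgroup.zpowers (g ^ (p ^ k))).topologicalClosure at hy
    rw [dist_eq_norm, ← hinv]
    have h0 : PadicInt.toZModPow k (Φ₀ (x⁻¹ * y)) = ((0 : ℤ) : ZMod (p ^ k)) :=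
      hchar (x⁻¹ * y) k 0 (by rwa [zpow_zero, inv_one, one_mul])
    rw [Int.cast_zero] at h0
    have hmem : Φ₀ (x⁻¹ * y) ∈ Ideal.span {(p : ℤ_[p]) ^ k} := by
      rw [← PadicInt.ker_toZModPow]; exact h0
    have hle : ‖Φ₀ (x⁻¹ * y)‖ ≤ (p : ℝ) ^ (-(k : ℤ)) :=
      (PadicInt.norm_le_pow_iff_mem_span_pow _ k).mpr hmem
    exact lt_of_le_of_lt hle hk
  refine ⟨Φ, ?_, fun x k i hi => hchar x k i hi⟩
  exact continuous_ofAdd.comp hcont₀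

end Coordinate

/-! ### Coprime indices; membership in all open subgroups -/

section Assembly

variable [T2Space G] {g : G}

omit [T2Space G] in
/-- `closure ⟨g^{ab}⟩ ≤ closure ⟨g^a⟩`. [folklore] -/
private theorem closureZpowersPow_mul_le (a b : ℕ) :
    (Subgroup.zpowers (g ^ (a * b))).topologicalClosure ≤
      (Subgroup.zpowers (g ^ a)).topologicalClosure := by
  refine Subgroup.topologicalClosure_mono ?_
  rw [Subgroup.zpowers_le, pow_mul]
  exact Subgroup.pow_mem _ (Subgroup.mem_zpowers _) _

/-- For coprime `a, b ≥ 1`: `closure ⟨gᵃ⟩ ∩ closure ⟨gᵇ⟩ = closure ⟨g^{ab}⟩` (both are the open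
subgroup of index `ab`). [cite: MochizukiAbsTopI2012, §0 p.7] -/
theorem closureZpowersPow_inf_of_coprime (hg : Dense (Subgroup.zpowers g : Set G)) {a b : ℕ}
    (ha : 0 < a) (hb : 0 < b) (hab : Nat.Coprime a b)
    (hexa : ∃ H : Subgroup G, IsOpen (H : Set G) ∧ H.index = a)
    (hexb : ∃ H : Subgroup G, IsOpen (H : Set G) ∧ H.index = b) :
    (Subgroup.zpowers (g ^ a)).topologicalClosure ⊓ (Subgroup.zpowers (g ^ b)).topologicalClosure =
      (Subgroup.zpowers (g ^ (a * b))).topologicalClosure := by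
  set Ka := (Subgroup.zpowers (g ^ a)).topologicalClosure with hKa
  set Kb := (Subgroup.zpowers (g ^ b)).topologicalClosure with hKb
  obtain ⟨hKao, hKai⟩ := isOpen_closureZpowersPow hg ha hexa
  obtain ⟨hKbo, hKbi⟩ := isOpen_closureZpowersPow hg hb hexb
  have hopen : IsOpen ((Ka ⊓ Kb : Subgroup G) : Set G) := by
    rw [Subgroup.coe_inf]; exact hKao.inter hKbo
  -- the index `c` of `Ka ⊓ Kb` is a positive multiple of `ab` and `≤ ab`
  set c := (Ka ⊓ Kb).index with hc
  have hca : a ∣ c := hKai ▸ Subgroup.index_dvd_of_le inf_le_left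
  have hcb : b ∣ c := hKbi ▸ Subgroup.index_dvd_of_le inf_le_right
  have habc : a * b ∣ c := hab.mul_dvd_of_dvd_of_dvd hca hcb
  have hcle : c ≤ a * b := by
    have h := Subgroup.index_inf_le (H := Ka) (K := Kb)
    rw [hKai, hKbi] at h
    exact h
  haveI : Ka.FiniteIndex := ⟨by rw [hKai]; exact ha.ne'⟩
  haveI : Kb.FiniteIndex := ⟨by rw [hKbi]; exact hb.ne'⟩
  have hcne : c ≠ 0 := Subgroup.index_inf_ne_zero Subgroup.FiniteIndex.index_ne_zero
    Subgroup.FiniteIndex.index_ne_zero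
  have hceq : c = a * b := by
    obtain ⟨t, ht⟩ := habc
    rcases Nat.eq_zero_or_pos t with h0 | hpos
    · rw [ht, h0, mul_zero] at hcne; exact absurd rfl hcne
    · have : a * b * 1 ≤ a * b * t := Nat.mul_le_mul_left _ hpos
      rw [mul_one, ← ht] at this
      exact le_antisymm hcle this
  exact eq_closureZpowersPow_of_isOpen_of_index hg hopen (Nat.mul_pos ha hb) hceq

/-- A divisor of a `Σ`-integer is a `Σ`-integer. [folklore] -/
private theorem isSigmaInteger_of_dvd {S : Set ℕ} {a n : ℕ} (ha : 0 < a) (han : a ∣ n)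
    (hn : IsSigmaInteger S n) : IsSigmaInteger S a :=
  ⟨ha, fun q hq hqa => hn.2 q hq (dvd_trans hqa han)⟩

/-- If `x` lies in `closure ⟨g^{pᵏ}⟩` for every prime power `pᵏ` with `p ∈ Σ`, and open subgroups
of every `Σ`-integer index exist, then `x` lies in `closure ⟨gⁿ⟩` for every `Σ`-integer `n`
(induction over the prime factorization, coprime pieces by the previous lemma). [folklore] -/
private theorem mem_closureZpowersPow_of_forall_primePow {S : Set ℕ}
    (hg : Dense (Subgroup.zpowers g : Set G))
    (hall : ∀ n : ℕ, IsSigmaInteger S n → ∃ H : Subgroup G, IsOpen (H : Set G) ∧ H.index = n)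
    {x : G}
    (hx : ∀ p k : ℕ, p.Prime → p ∈ S → x ∈ (Subgroup.zpowers (g ^ (p ^ k))).topologicalClosure)
    {n : ℕ} (hn : IsSigmaInteger S n) : x ∈ (Subgroup.zpowers (g ^ n)).topologicalClosure := by
  induction n using Nat.recOnPosPrimePosCoprime with
  | prime_pow p k hp hk =>
    exact hx p k hp (hn.2 p hp (dvd_pow_self p hk.ne'))
  | zero => exact absurd hn.1 (lt_irrefl 0)
  | one =>
    -- `closure ⟨g⟩ = ⊤`
    have : ((Subgroup.zpowers (g ^ 1)).topologicalClosure : Set G) = Set.univ := by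
      rw [pow_one, Subgroup.topologicalClosure_coe, hg.closure_eq]
    have hmem : x ∈ ((Subgroup.zpowers (g ^ 1)).topologicalClosure : Set G) := by
      rw [this]; trivial
    exact hmem
  | coprime a b ha hb hab iha ihb =>
    have ha0 : 0 < a := lt_trans Nat.zero_lt_one ha
    have hb0 : 0 < b := lt_trans Nat.zero_lt_one hb
    have hSa : IsSigmaInteger S a := isSigmaInteger_of_dvd ha0 (Dvd.intro b rfl) hn
    have hSb : IsSigmaInteger S b := isSigmaInteger_of_dvd hb0 (Dvd.intro_left a rfl) hn
    rw [← closureZpowersPow_inf_of_coprime hg ha0 hb0 hab (hall a hSa) (hall b hSb)]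
    exact ⟨iha hSa, ihb hSb⟩

/-- Hence such an `x` lies in EVERY open subgroup of a compact group all of whose open subgroups
have `Σ`-integer index (each is some `closure ⟨gⁿ⟩`). [folklore] -/
private theorem mem_of_isOpen_of_forall_primePow {S : Set ℕ} [CompactSpace G]
    (hg : Dense (Subgroup.zpowers g : Set G))
    (hall : ∀ n : ℕ, IsSigmaInteger S n → ∃ H : Subgroup G, IsOpen (H : Set G) ∧ H.index = n)
    (hidx : ∀ H : Subgroup G, IsOpen (H : Set G) → IsSigmaInteger S H.index) {x : G}
    (hx : ∀ p k : ℕ, p.Prime → p ∈ S → x ∈ (Subgroup.zpowers (g ^ (p ^ k))).topologicalClosure)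
    (H : Subgroup G) (hH : IsOpen (H : Set G)) : x ∈ H := by
  have hS := hidx H hH
  rw [eq_closureZpowersPow_of_isOpen_of_index hg hH hS.1 rfl]
  exact mem_closureZpowersPow_of_forall_primePow hg hall hx hS

end Assembly

/-! ### `ℕ` is dense in `∏_p ℤ_p` (Chinese remainder theorem) -/

section Density

/-- **`ℕ` is dense in `∏_{i} ℤ_{qᵢ}`** for any family of DISTINCT primes `qᵢ` (diagonal
embedding): for finitely many indices and exponents `kᵢ`, an integer `m` with prescribed residues
mod `qᵢ^{kᵢ}` exists (Chinese remainder theorem), and `m ≡ tᵢ mod qᵢ^{kᵢ}` means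
`‖m - tᵢ‖ ≤ qᵢ^{-kᵢ}`. [cite: MochizukiAbsTopI2012, §0 p.7] -/
theorem dense_range_natCast_padicFamily {ι : Type*} (q : ι → ℕ) (hq : ∀ i, (q i).Prime)
    (hinj : Function.Injective q) :
    Dense (Set.range (fun m : ℕ => (fun i : ι => ((m : ℕ) : @PadicInt (q i) ⟨hq i⟩)))) := by
  rw [dense_iff_inter_open]
  intro U hU ⟨t, htU⟩
  obtain ⟨I, u, hu, hIU⟩ := isOpen_pi_iff.mp hU t htU
  -- per coordinate in `I`: a radius, then an exponent
  have hball : ∀ i : ι, i ∈ I → ∃ k : ℕ, ∀ y : @PadicInt (q i) ⟨hq i⟩,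
      ‖y - t i‖ ≤ ((q i : ℕ) : ℝ) ^ (-(k : ℤ)) → y ∈ u i := by
    intro i hi
    haveI : Fact (Nat.Prime (q i)) := ⟨hq i⟩
    obtain ⟨ε, hε, hεu⟩ := Metric.isOpen_iff.mp (hu i hi).1 (t i) (hu i hi).2
    obtain ⟨k, hk⟩ := PadicInt.exists_pow_neg_lt (q i) hε
    refine ⟨k, fun y hy => hεu ?_⟩
    rw [Metric.mem_ball, dist_eq_norm]
    exact lt_of_le_of_lt hy hk
  classical
  choose! k hk using hball
  -- CRT
  let s : ι → ℕ := fun i => (q i) ^ k i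
  let a : ι → ℕ := fun i => (@PadicInt.toZModPow (q i) ⟨hq i⟩ (k i) (t i)).val
  have hs : ∀ i ∈ I, s i ≠ 0 := fun i _ => (pow_pos (hq i).pos _).ne'
  have hcop : Set.Pairwise (↑I : Set ι) (fun i j => Nat.Coprime (s i) (s j)) := by
    intro i _ j _ hij
    have hij' : q i ≠ q j := fun h => hij (hinj h)
    exact ((Nat.coprime_primes (hq i) (hq j)).mpr hij').pow _ _
  obtain ⟨m, hm⟩ := Nat.chineseRemainderOfFinset a s I hs hcop
  refine ⟨fun i => ((m : ℕ) : @PadicInt (q i) ⟨hq i⟩), hIU ?_, ⟨m, rfl⟩⟩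
  rw [Set.mem_pi]
  intro i hi
  haveI : Fact (Nat.Prime (q i)) := ⟨hq i⟩
  apply hk i (Finset.mem_coe.mp hi)
  -- `m ≡ a_i mod q_i^k` ⇒ `toZModPow k (m - t_i) = 0` ⇒ norm estimate
  have hmod : (m : ZMod ((q i) ^ k i)) = PadicInt.toZModPow (k i) (t i) := by
    have h1 := (ZMod.natCast_eq_natCast_iff' m (a i) ((q i) ^ k i)).mpr
      (hm i (Finset.mem_coe.mp hi))
    rw [h1]
    exact ZMod.natCast_zmod_val _
  have hker : ((m : ℕ) : ℤ_[q i]) - t i ∈ Ideal.span {((q i : ℕ) : ℤ_[q i]) ^ k i} := by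
    rw [← PadicInt.ker_toZModPow, RingHom.mem_ker, map_sub, map_natCast, hmod, sub_self]
  exact (PadicInt.norm_le_pow_iff_mem_span_pow _ (k i)).mpr hker

/-- **`ℕ` is dense in `∏_p ℤ_p`** (all primes). [cite: MochizukiAbsTopI2012, §0 p.7] -/
theorem dense_range_natCast_padicProd :
    Dense (Set.range
      (fun m : ℕ => (fun p : Nat.Primes => ((m : ℕ) : @PadicInt (p : ℕ) ⟨p.2⟩)))) :=
  dense_range_natCast_padicFamily (fun p : Nat.Primes => (p : ℕ)) (fun p => p.2)
    Nat.Primes.coe_nat_injective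

end Density

/-! ### The structure theorem -/

section Structure

/-- **Structure theorem for free pro-`Σ`-cyclic compact groups** ([AbsTopII] Prop 1.3 (i): "as
abstract profinite groups, `≅ Ẑ^Σ`", typed intrinsically as `AbsTopII.IsFreeProSigmaCyclic Σ`): a
compact Hausdorff totally disconnected group with a dense cyclic subgroup whose open subgroups have
exactly the `Σ`-integers as indices is isomorphic, as a topological group, to `Ẑ^Σ = ∏_{p ∈ Σ} ℤ_p`
(written multiplicatively; indices = the primes `p : Nat.Primes` with `p ∈ Σ`), the topological
generator going to `1`. [cite: MochizukiAbsTopII2013, Prop 1.3 (i) p.11] -/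
theorem AbsTopII.IsFreeProSigmaCyclic.exists_continuousMulEquiv_padicSigmaProd {S : Set ℕ}
    [CompactSpace G] [T2Space G] [TotallyDisconnectedSpace G]
    (h : AbsTopII.IsFreeProSigmaCyclic S G) :
    ∃ e : G ≃ₜ* Multiplicative (∀ p : {p : Nat.Primes // (p : ℕ) ∈ S}, @PadicInt (p.1 : ℕ) ⟨p.1.2⟩),
      ∃ g : G, Dense (Subgroup.zpowers g : Set G) ∧ Multiplicative.toAdd (e g) = 1 := by
  classical
  obtain ⟨g, hg⟩ := h.exists_dense_zpowers
  have hall : ∀ n : ℕ, IsSigmaInteger S n → ∃ H : Subgroup G, IsOpen (H : Set G) ∧ H.index = n :=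
    fun n hn => (h.isOpen_index_iff n).mpr hn
  have hidxS : ∀ H : Subgroup G, IsOpen (H : Set G) → IsSigmaInteger S H.index :=
    fun H hH => (h.isOpen_index_iff H.index).mp ⟨H, hH, rfl⟩
  -- prime powers of primes in `Σ` are `Σ`-integers
  have hpow : ∀ (p : {p : Nat.Primes // (p : ℕ) ∈ S}) (k : ℕ),
      ∃ H : Subgroup G, IsOpen (H : Set G) ∧ H.index = (p.1 : ℕ) ^ k := by
    intro p k
    refine hall _ ⟨pow_pos p.1.2.pos k, fun q hq hqd => ?_⟩
    have := (Nat.prime_dvd_prime_iff_eq hq p.1.2).mp (hq.dvd_of_dvd_pow hqd)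
    rw [this]; exact p.2
  have key : ∀ p : {p : Nat.Primes // (p : ℕ) ∈ S},
      ∃ Φ : G →* Multiplicative (@PadicInt (p.1 : ℕ) ⟨p.1.2⟩),
      Continuous Φ ∧ ∀ (x : G) (k : ℕ) (i : ℤ),
        (g ^ i)⁻¹ * x ∈ (Subgroup.zpowers (g ^ ((p.1 : ℕ) ^ k))).topologicalClosure →
          @PadicInt.toZModPow (p.1 : ℕ) ⟨p.1.2⟩ k (Multiplicative.toAdd (Φ x)) =
            (i : ZMod ((p.1 : ℕ) ^ k)) :=
    fun p => @exists_padicCoordinate G _ _ _ _ g hg (p.1 : ℕ) ⟨p.1.2⟩ (hpow p)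
  choose Φ hcont hchar using key
  -- the product map, additively
  let F : G → (∀ p : {p : Nat.Primes // (p : ℕ) ∈ S}, @PadicInt (p.1 : ℕ) ⟨p.1.2⟩) :=
    fun x p => Multiplicative.toAdd (Φ p x)
  have hFmul : ∀ x y : G, F (x * y) = F x + F y := by
    intro x y; funext p
    change Multiplicative.toAdd (Φ p (x * y)) =
      Multiplicative.toAdd (Φ p x) + Multiplicative.toAdd (Φ p y)
    rw [map_mul]; rfl
  have hFinv : ∀ x : G, F x⁻¹ = - F x := by
    intro x; funext p
    change Multiplicative.toAdd (Φ p x⁻¹) = - Multiplicative.toAdd (Φ p x)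
    rw [map_inv]; rfl
  have hFcont : Continuous F := continuous_pi fun p => continuous_toAdd.comp (hcont p)
  -- reading membership in `closure ⟨g^{p^k}⟩` off the coordinates
  have hmem_of_zero : ∀ (x : G) (p : {p : Nat.Primes // (p : ℕ) ∈ S}) (k : ℕ),
      @PadicInt.toZModPow (p.1 : ℕ) ⟨p.1.2⟩ k (F x p) = 0 →
        x ∈ (Subgroup.zpowers (g ^ ((p.1 : ℕ) ^ k))).topologicalClosure := by
    intro x p k h0
    haveI : Fact (Nat.Prime (p.1 : ℕ)) := ⟨p.1.2⟩
    have hpk : 0 < (p.1 : ℕ) ^ k := pow_pos p.1.2.pos k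
    obtain ⟨i, -, hi⟩ := exists_residue hg hpk x
    have hci : ((i : ℤ) : ZMod ((p.1 : ℕ) ^ k)) = 0 := by rw [← hchar p x k i hi]; exact h0
    have hdvd : ((((p.1 : ℕ) ^ k : ℕ)) : ℤ) ∣ (i : ℤ) :=
      (ZMod.intCast_zmod_eq_zero_iff_dvd _ _).mp hci
    have hgi : g ^ (i : ℤ) ∈ (Subgroup.zpowers (g ^ ((p.1 : ℕ) ^ k))).topologicalClosure :=
      (zpow_mem_closureZpowersPow_iff hg hpk (isOpen_closureZpowersPow hg hpk (hpow p k)).2 _).mpr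
        hdvd
    have := Subgroup.mul_mem _ hgi hi
    rwa [mul_inv_cancel_left] at this
  -- injectivity
  have hker : ∀ x : G, F x = 0 → x = 1 := by
    intro x hx
    apply eq_one_of_forall_isOpen_mem
    apply mem_of_isOpen_of_forall_primePow hg hall hidxS
    intro p k hp hpS
    exact hmem_of_zero x ⟨⟨p, hp⟩, hpS⟩ k (by rw [hx]; exact map_zero _)
  have hinj : Function.Injective F := by
    intro x y hxy
    have h1 : F (x * y⁻¹) = 0 := by rw [hFmul, hFinv, hxy, add_neg_cancel]
    have := hker _ h1
    rwa [mul_inv_eq_one] at this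
  -- the generator goes to `1`
  have hF1 : F 1 = 0 := by
    have := hFmul 1 1
    rw [mul_one] at this
    simpa using this
  have hFg : F g = 1 := by
    funext p
    rw [Pi.one_apply]
    haveI : Fact (Nat.Prime (p.1 : ℕ)) := ⟨p.1.2⟩
    apply PadicInt.ext_of_toZModPow.mp
    intro k
    have h1 : (g ^ (1 : ℤ))⁻¹ * g ∈
        (Subgroup.zpowers (g ^ ((p.1 : ℕ) ^ k))).topologicalClosure := by
      rw [zpow_one, inv_mul_cancel]; exact Subgroup.one_mem _
    have := hchar p g k 1 h1
    rw [Int.cast_one] at this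
    rw [map_one]
    exact this
  have hFpow : ∀ m : ℕ, F (g ^ m) =
      fun p : {p : Nat.Primes // (p : ℕ) ∈ S} => (m : @PadicInt (p.1 : ℕ) ⟨p.1.2⟩) := by
    intro m
    induction m with
    | zero =>
      rw [pow_zero, hF1]
      funext p
      simp
    | succ m ih =>
      rw [pow_succ, hFmul, ih, hFg]
      funext p
      simp
  -- surjectivity: closed dense range
  have hsurj : Function.Surjective F := by
    have hclosed : IsClosed (Set.range F) := (isCompact_range hFcont).isClosed
    have hdense : Dense (Set.range F) := by
      refine (dense_range_natCast_padicFamily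
        (fun p : {p : Nat.Primes // (p : ℕ) ∈ S} => (p.1 : ℕ)) (fun p => p.1.2)
        (fun p q hpq => Subtype.ext (Nat.Primes.coe_nat_injective hpq))).mono ?_
      rintro _ ⟨m, rfl⟩
      exact ⟨g ^ m, hFpow m⟩
    intro y
    have : y ∈ Set.range F := by
      rw [← hclosed.closure_eq, hdense.closure_eq]; trivial
    exact this
  -- package
  let e : G ≃ (∀ p : {p : Nat.Primes // (p : ℕ) ∈ S}, @PadicInt (p.1 : ℕ) ⟨p.1.2⟩) :=
    Equiv.ofBijective F ⟨hinj, hsurj⟩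
  let eₜ : G ≃ₜ (∀ p : {p : Nat.Primes // (p : ℕ) ∈ S}, @PadicInt (p.1 : ℕ) ⟨p.1.2⟩) :=
    Continuous.homeoOfEquivCompactToT2 (f := e) hFcont
  let E : G ≃ₜ*
      Multiplicative (∀ p : {p : Nat.Primes // (p : ℕ) ∈ S}, @PadicInt (p.1 : ℕ) ⟨p.1.2⟩) :=
    { toFun := fun x => Multiplicative.ofAdd (F x),
      invFun := fun y => eₜ.symm (Multiplicative.toAdd y),
      left_inv := fun x => eₜ.symm_apply_apply x,
      right_inv := fun y => by
        change Multiplicative.ofAdd (eₜ (eₜ.symm (Multiplicative.toAdd y))) = y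
        rw [eₜ.apply_symm_apply]; rfl,
      map_mul' := fun x y => by rw [hFmul]; rfl,
      continuous_toFun := continuous_ofAdd.comp hFcont,
      continuous_invFun := eₜ.symm.continuous.comp continuous_toAdd }
  exact ⟨E, g, hg, hFg⟩

/-- `IsFreeProcyclic` is `IsFreeProSigmaCyclic` for `Σ` = all primes on a compact group (an open
subgroup of a compact group has positive index). [cite: MochizukiAbsTopII2013, Prop 1.3 (i) p.11] -/
theorem FundamentalExtension.IsFreeProcyclic.isFreeProSigmaCyclic_univ' [CompactSpace G]
    (h : FundamentalExtension.IsFreeProcyclic G) : AbsTopII.IsFreeProSigmaCyclic Set.univ G where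
  exists_dense_zpowers := h.exists_dense_zpowers
  isOpen_index_iff n := by
    constructor
    · rintro ⟨H, hH, rfl⟩
      haveI : Finite (G ⧸ H) := Subgroup.quotient_finite_of_isOpen H hH
      haveI : H.FiniteIndex := Subgroup.finiteIndex_of_finite_quotient
      exact ⟨Nat.pos_of_ne_zero Subgroup.FiniteIndex.index_ne_zero, fun _ _ _ => Set.mem_univ _⟩
    · exact fun hn => h.exists_isOpen_index n hn.1

/-- **Structure theorem for free procyclic compact groups.** A compact Hausdorff totally
disconnected topological group which is topologically generated by one element and has an open
subgroup of every positive index (`FundamentalExtension.IsFreeProcyclic`, the interface predicate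
for "`≅ Ẑ`" of [AbsTopIII] Prop 1.4 (i) / [AbsTopI] §0 p. 7) is isomorphic, as a topological group,
to `Ẑ = ∏_p ℤ_p` (written multiplicatively), the topological generator going to `1`. [cite:
MochizukiAbsTopIII2015, Prop 1.4 (i) p.31] -/
theorem FundamentalExtension.IsFreeProcyclic.exists_continuousMulEquiv_padicProd [CompactSpace G]
    [T2Space G] [TotallyDisconnectedSpace G] (h : FundamentalExtension.IsFreeProcyclic G) :
    ∃ e : G ≃ₜ* Multiplicative (∀ p : Nat.Primes, @PadicInt (p : ℕ) ⟨p.2⟩),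
      ∃ g : G, Dense (Subgroup.zpowers g : Set G) ∧ Multiplicative.toAdd (e g) = 1 := by
  obtain ⟨E, g, hg, hEg⟩ := h.isFreeProSigmaCyclic_univ'.exists_continuousMulEquiv_padicSigmaProd
  -- reindex `{p : Nat.Primes // ↑p ∈ univ} ≃ Nat.Primes`
  let r : (∀ p : {p : Nat.Primes // (p : ℕ) ∈ Set.univ}, @PadicInt (p.1 : ℕ) ⟨p.1.2⟩) ≃ₜ+
      (∀ p : Nat.Primes, @PadicInt (p : ℕ) ⟨p.2⟩) :=
    { toFun := fun f p => f ⟨p, Set.mem_univ _⟩,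
      invFun := fun f p => f p.1,
      left_inv := fun f => rfl,
      right_inv := fun f => rfl,
      map_add' := fun f f' => rfl,
      continuous_toFun := continuous_pi fun p => continuous_apply _,
      continuous_invFun := continuous_pi fun p => continuous_apply _ }
  refine ⟨{ toFun := fun x => Multiplicative.ofAdd (r (Multiplicative.toAdd (E x))),
            invFun := fun y => E.symm (Multiplicative.ofAdd (r.symm (Multiplicative.toAdd y))),
            left_inv := fun x => by
              change E.symm (Multiplicative.ofAdd (r.symm (r (Multiplicative.toAdd (E x))))) = x
              rw [r.symm_apply_apply]
              exact E.symm_apply_apply x,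
            right_inv := fun y => by
              change Multiplicative.ofAdd (r (Multiplicative.toAdd (E (E.symm
                (Multiplicative.ofAdd (r.symm (Multiplicative.toAdd y))))))) = y
              rw [E.apply_symm_apply]
              change Multiplicative.ofAdd (r (r.symm (Multiplicative.toAdd y))) = y
              rw [r.apply_symm_apply]; rfl,
            map_mul' := fun x y => by rw [map_mul]; rfl,
            continuous_toFun := continuous_ofAdd.comp (r.continuous.comp
              (continuous_toAdd.comp E.continuous)),
            continuous_invFun := E.symm.continuous.comp (continuous_ofAdd.comp
              (r.symm.continuous.comp continuous_toAdd)) }, g, hg, ?_⟩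
  change r (Multiplicative.toAdd (E g)) = 1
  rw [hEg]; rfl

/-- **Additive form** (for consumers working with `Additive I`, e.g. the synchronization
`Additive I_x →+ M_X` of [AbsTopIII] Thm 1.9 (b)): a free procyclic compact Hausdorff totally
disconnected group is `≃ₜ+ ∏_p ℤ_p` after passing to `Additive`, the topological generator going to
`1`. [cite: MochizukiAbsTopIII2015, Prop 1.4 (i) p.31] -/
theorem FundamentalExtension.IsFreeProcyclic.exists_continuousAddEquiv_padicProd [CompactSpace G]
    [T2Space G] [TotallyDisconnectedSpace G] (h : FundamentalExtension.IsFreeProcyclic G) :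
    ∃ e : Additive G ≃ₜ+ (∀ p : Nat.Primes, @PadicInt (p : ℕ) ⟨p.2⟩),
      ∃ g : G, Dense (Subgroup.zpowers g : Set G) ∧ e (Additive.ofMul g) = 1 := by
  obtain ⟨E, g, hg, hEg⟩ := h.exists_continuousMulEquiv_padicProd
  refine ⟨{ toFun := fun x => Multiplicative.toAdd (E (Additive.toMul x)),
            invFun := fun y => Additive.ofMul (E.symm (Multiplicative.ofAdd y)),
            left_inv := fun x => by
              change Additive.ofMul (E.symm (Multiplicative.ofAdd
                (Multiplicative.toAdd (E (Additive.toMul x))))) = x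
              rw [ofAdd_toAdd, E.symm_apply_apply]; rfl,
            right_inv := fun y => by
              change Multiplicative.toAdd (E (Additive.toMul (Additive.ofMul
                (E.symm (Multiplicative.ofAdd y))))) = y
              rw [toMul_ofMul, E.apply_symm_apply]; rfl,
            map_add' := fun x y => by
              change Multiplicative.toAdd (E (Additive.toMul x * Additive.toMul y)) = _
              rw [map_mul]; rfl,
            continuous_toFun := continuous_toAdd.comp (E.continuous.comp continuous_toMul),
            continuous_invFun :=
              continuous_ofMul.comp (E.symm.continuous.comp continuous_ofAdd) }, g, hg, ?_⟩
  exact hEg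

/-- **Closed-subgroup form**: a CLOSED subgroup `I` of a compact Hausdorff totally disconnected
group (e.g. an inertia group `I_x ⊆ Π` in a profinite `Π`) satisfying `IsFreeProcyclic I` is `≃ₜ*
Multiplicative (∏_p ℤ_p)` ("`I_x ≅ Ẑ(1)`" as abstract profinite groups). [cite:
MochizukiAbsTopIII2015, Prop 1.4 (i) p.31] -/
theorem FundamentalExtension.IsFreeProcyclic.exists_continuousMulEquiv_padicProd_of_isClosed
    [CompactSpace G] [T2Space G] [TotallyDisconnectedSpace G] {I : Subgroup G}
    (hI : IsClosed (I : Set G)) (h : FundamentalExtension.IsFreeProcyclic I) :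
    ∃ e : I ≃ₜ* Multiplicative (∀ p : Nat.Primes, @PadicInt (p : ℕ) ⟨p.2⟩),
      ∃ g : I, Dense (Subgroup.zpowers g : Set I) ∧ Multiplicative.toAdd (e g) = 1 := by
  haveI : CompactSpace I := isCompact_iff_compactSpace.mp hI.isCompact
  exact h.exists_continuousMulEquiv_padicProd

/-- **[AbsTopII] Prop 1.3 (i)'s typing validated for `Σ` = all primes**: a compact Hausdorff totally
disconnected group with `AbsTopII.IsFreeProSigmaCyclic Set.univ` ("as abstract profinite groups,
`≅ Ẑ^Σ`" typed intrinsically) is `≃ₜ* Multiplicative (∏_p ℤ_p)`.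
[cite: MochizukiAbsTopII2013, Prop 1.3 (i) p.11] -/
theorem AbsTopII.IsFreeProSigmaCyclic.exists_continuousMulEquiv_padicProd [CompactSpace G]
    [T2Space G] [TotallyDisconnectedSpace G] (h : AbsTopII.IsFreeProSigmaCyclic Set.univ G) :
    ∃ e : G ≃ₜ* Multiplicative (∀ p : Nat.Primes, @PadicInt (p : ℕ) ⟨p.2⟩),
      ∃ g : G, Dense (Subgroup.zpowers g : Set G) ∧ Multiplicative.toAdd (e g) = 1 := by
  have h' : FundamentalExtension.IsFreeProcyclic G :=
    ⟨h.exists_dense_zpowers, fun n hn =>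
      (h.isOpen_index_iff n).mpr ⟨hn, fun _ _ _ => Set.mem_univ _⟩⟩
  exact h'.exists_continuousMulEquiv_padicProd

/-- **`ULift`ed additive form**, matching the cell's cyclotome coefficients
`AbsTopIII.ZHatCoeff.{u} = ULift.{u} (∀ p : Nat.Primes, ℤ_[p])` verbatim: a free procyclic compact
Hausdorff totally disconnected group is `≃ₜ+ ULift (∏_p ℤ_p)` after passing to `Additive`, the
topological generator going to `1`. [cite: MochizukiAbsTopIII2015, Prop 1.4 (i) p.31] -/
theorem FundamentalExtension.IsFreeProcyclic.exists_continuousAddEquiv_ulift_padicProd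
    [CompactSpace G] [T2Space G] [TotallyDisconnectedSpace G]
    (h : FundamentalExtension.IsFreeProcyclic G) :
    ∃ e : Additive G ≃ₜ+ ULift.{u} (∀ p : Nat.Primes, @PadicInt (p : ℕ) ⟨p.2⟩),
      ∃ g : G, Dense (Subgroup.zpowers g : Set G) ∧ e (Additive.ofMul g) = ULift.up 1 := by
  obtain ⟨e, g, hg, heg⟩ := h.exists_continuousAddEquiv_padicProd
  refine ⟨{ toFun := fun x => ULift.up (e x),
            invFun := fun y => e.symm (ULift.down y),
            left_inv := fun x => e.symm_apply_apply x,
            right_inv := fun y => by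
              change ULift.up (e (e.symm (ULift.down y))) = y
              rw [e.apply_symm_apply],
            map_add' := fun x y => by rw [map_add]; rfl,
            continuous_toFun := continuous_uliftUp.comp e.continuous,
            continuous_invFun := e.symm.continuous.comp continuous_uliftDown }, g, hg, ?_⟩
  change ULift.up (e (Additive.ofMul g)) = ULift.up 1
  rw [heg]

end Structure

end Literature.AnabelianGeometry.AbsoluteAnabelian
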